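import Summits.AnomalousDissipation.AnomalousDissipation.Theorems.SolenoidalFractalHomogenisationRealisedQuasiStaticCellLawSlotGainFrame
import Summits.AnomalousDissipation.AnomalousDissipation.Theorems.SolenoidalFractalHomogenisationRealisedQuasiStaticCellLawIsotropicGainScale
import Summits.AnomalousDissipation.AnomalousDissipation.Theorems.SolenoidalFractalHomogenisationRealisedQuasiStaticCellLawCouplingAlgebra
import Summits.AnomalousDissipation.AnomalousDissipation.Theorems.SolenoidalFractalHomogenisationRealisedQuasiStaticCellLawInPlaneBlock
import Literature.Analysis.FunctionSpaces.TorusHeatSmoothing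
import HarnessLib

/-!
# K2R `RealisedQuasiStaticCellLaw`, line `floquet-bloch`, stub `stub_upperSome`: the isotropic sum of the nominal
# polarisation-weighted slot exponents over one period (complex slow vector)

Summits-side helper (everything proved; no definitions, no named facts; `--supports stmt-AnomalousDissipation-20446`).
For a word `W` with `IsotropicWordGain W c₀`, a cell number `n ≥ 1`, viscosity `κ > 0`, a label `ℓ ≠ 0` with unit direction
`q = ℓ/|ℓ|`, per-slot real unit normals `ζ_j ⊥ ℓ, K_j` (`K_j = n m_j`) and in-plane directions `π_j = q × ζ_j`, and ANY complex
vector `b ⊥ ℓ` (the slow Galerkin amplitude): with `Λ_j = κ4π²|K_j|²`, the peak coupling `g₁,j = 2π(ê_j·ℓ)|a_j|/(nΛ_j)` and the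
in-plane factor `⟪m̂_j, q⟫²`,
`Σ_j Λ_j τ_j g₁,j² (‖⟪ζ_j, b⟫‖² + ⟪m̂_j,q⟫² ‖⟪π_j, b⟫‖²) = (2π²|ℓ|²/(κn⁴))·c₀·period·‖b‖²`
(`isotropic_exponent_sum`): per slot `Λτg₁² = (2π²/(κn⁴))·τθ²/(2(2π|m|)⁴)` (`slot_exponent_eq_slotWeight`), the bracket is the
polarisation factor of `slotGain` in the slot frame (`slotGain_frame`) applied to the real and imaginary parts of `b`, and
the slot sum is isotropic (`isotropicWordGain_norm_sq`). Energy LOWER-bound half of the K2R bracket; not anomalous dissipation.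
-/

set_option linter.dupNamespace false -- layout D-0017: `AnomalousDissipation.AnomalousDissipation` repeats by design

noncomputable section

namespace Summit.AnomalousDissipation.AnomalousDissipation.Theorems.SolenoidalFractalHomogenisation.RealisedQuasiStaticCellLaw

open Matrix Complex
open scoped Matrix InnerProductSpace RealInnerProductSpace ComplexConjugate BigOperators
open Literature.Analysis Literature.Analysis.FunctionSpaces Literature.Analysis.FunctionSpaces.Torus
open Literature.Analysis.FluidPDE Literature.Analysis.FluidPDE.LatticeShear

/-- The squared modulus of the component of `b ∈ ℂ³` along a cast real vector `u` splits into the components of the real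
and imaginary parts of `b`: `‖⟪u, b⟫‖² = (u·Re b)² + (u·Im b)²`. -/
theorem norm_sq_inner_toLp_ofReal (u : Fin 3 → ℝ) (b : EuclideanSpace ℂ (Fin 3)) :
    ‖inner ℂ (WithLp.toLp 2 (Complex.ofReal ∘ u) : EuclideanSpace ℂ (Fin 3)) b‖ ^ 2 =
      (u ⬝ᵥ fun i => (b i).re) ^ 2 + (u ⬝ᵥ fun i => (b i).im) ^ 2 := by
  rw [inner_toLp_ofReal_comp, Complex.sq_norm, Complex.normSq_apply]
  have hre : ((Complex.ofReal ∘ u) ⬝ᵥ WithLp.ofLp b).re = u ⬝ᵥ fun i => (b i).re := by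
    simp only [dotProduct, Function.comp_apply, Complex.re_sum, Complex.re_ofReal_mul]
  have him : ((Complex.ofReal ∘ u) ⬝ᵥ WithLp.ofLp b).im = u ⬝ᵥ fun i => (b i).im := by
    simp only [dotProduct, Function.comp_apply, Complex.im_sum, Complex.im_ofReal_mul]
  rw [hre, him]; ring

/-- `‖b‖² = ‖Re b‖² + ‖Im b‖²` for `b ∈ ℂ³`, the parts taken coordinatewise as vectors of `ℝ³`. -/
theorem norm_sq_eq_re_add_im (b : EuclideanSpace ℂ (Fin 3)) :
    ‖b‖ ^ 2 = ‖(WithLp.toLp 2 (fun i => (b i).re) : EuclideanSpace ℝ (Fin 3))‖ ^ 2 +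
      ‖(WithLp.toLp 2 (fun i => (b i).im) : EuclideanSpace ℝ (Fin 3))‖ ^ 2 := by
  rw [EuclideanSpace.norm_sq_eq, EuclideanSpace.norm_sq_eq, EuclideanSpace.norm_sq_eq, ← Finset.sum_add_distrib]
  refine Finset.sum_congr rfl fun i _ => ?_
  simp only [Real.norm_eq_abs, sq_abs, Complex.sq_norm, Complex.normSq_apply]
  ring

/-- **One slot: the nominal exponent against the slot gain.** For a lattice phase `P = (m, ê, τ, φ)`, `n ≥ 1`, `κ > 0`,
`ℓ ≠ 0`, `q = ℓ/|ℓ|`, a real unit `ζ ⊥ ℓ, m` and a REAL polarisation `p ⊥ q`: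
`Λτg₁²·((ζ·p)² + ⟪m̂,q⟫²((q×ζ)·p)²) = (2π²|ℓ|²/(κn⁴))·slotGain P q p`. -/
theorem slot_exponent_frame (P : LatticePhase) {n : ℕ} (hn : 0 < n) {κ : ℝ} (hκ : 0 < κ) {ℓ : Fin 3 → ℤ} (hℓ : ℓ ≠ 0)
    {ζ : Fin 3 → ℝ} (hζ1 : ζ ⬝ᵥ ζ = 1) (hζ0 : ζ ⬝ᵥ (fun i => ((ℓ i : ℤ) : ℝ)) = 0)
    (hζm : ζ ⬝ᵥ (fun i => ((P.m i : ℤ) : ℝ)) = 0) (p : EuclideanSpace ℝ (Fin 3))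
    (hpq : ⟪p, (1 / ‖latticeVec ℓ‖) • latticeVec ℓ⟫ = 0) :
    κ * (4 * Real.pi ^ 2 * freqNormSq (fun i => P.m i * (n : ℤ))) * P.τ *
        (2 * Real.pi * (∑ i, P.e i * (ℓ i : ℝ)) *
            ‖Complex.exp (P.φ * Complex.I) * (1 / (2 * ((2 * Real.pi * ‖latticeVec P.m‖ : ℝ) : ℂ) * Complex.I))‖ *
            (1 / (n : ℝ)) / (κ * (4 * Real.pi ^ 2 * freqNormSq (fun i => P.m i * (n : ℤ))))) ^ 2 *
        ((ζ ⬝ᵥ WithLp.ofLp p) ^ 2 +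
          ⟪(1 / ‖latticeVec P.m‖) • latticeVec P.m, (1 / ‖latticeVec ℓ‖) • latticeVec ℓ⟫ ^ 2 *
            ((WithLp.ofLp ((1 / ‖latticeVec ℓ‖) • latticeVec ℓ) ⨯₃ ζ) ⬝ᵥ WithLp.ofLp p) ^ 2) =
      2 * Real.pi ^ 2 * freqNormSq ℓ / (κ * (n : ℝ) ^ 4) * slotGain P ((1 / ‖latticeVec ℓ‖) • latticeVec ℓ) p := by
  set A : ℝ := ‖latticeVec ℓ‖ with hA
  have hA0 : 0 < A := lt_of_lt_of_le one_pos (one_le_norm_latticeVec hℓ)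
  set q : EuclideanSpace ℝ (Fin 3) := (1 / A) • latticeVec ℓ with hq
  have hq1 : ‖q‖ = 1 := by
    rw [hq, norm_smul, Real.norm_eq_abs, abs_of_pos (by positivity), one_div, inv_mul_cancel₀ hA0.ne']
  have hinner : ∀ a b : EuclideanSpace ℝ (Fin 3), ⟪a, b⟫ = WithLp.ofLp a ⬝ᵥ WithLp.ofLp b := by
    intro a b
    rw [EuclideanSpace.inner_eq_star_dotProduct, star_trivial, dotProduct_comm]
  have hlr : WithLp.ofLp (latticeVec ℓ) = fun i => ((ℓ i : ℤ) : ℝ) := by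
    funext i; simp [latticeVec_apply]
  have hmr : WithLp.ofLp (latticeVec P.m) = fun i => ((P.m i : ℤ) : ℝ) := by
    funext i; simp [latticeVec_apply]
  have hζq : ζ ⬝ᵥ WithLp.ofLp q = 0 := by
    rw [hq, WithLp.ofLp_smul, dotProduct_smul, hlr, hζ0, smul_zero]
  have hζm' : ζ ⬝ᵥ WithLp.ofLp (latticeVec P.m) = 0 := by rw [hmr, hζm]
  rw [slot_exponent_eq_slotWeight P hn hκ, slotGain_frame P q p hq1 hpq hζ1 hζq hζm']
  -- `⟨ê, q⟩ = θ/|ℓ|`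
  have hθ : ⟪P.e, q⟫ = (1 / A) * ∑ i, P.e i * (ℓ i : ℝ) := by
    rw [hq, real_inner_smul_right, hinner, hlr]
    simp [dotProduct]
  have hAf : freqNormSq ℓ = A ^ 2 := by rw [← norm_latticeVec_sq]
  rw [hθ, hAf]
  have hn' : (0 : ℝ) < n := by exact_mod_cast hn
  field_simp

/-- **The isotropic period sum of the nominal polarisation-weighted exponents, complex slow vector.** See the module
docstring. -/
theorem isotropic_exponent_sum {k₀ : ℕ} (W : LatticeWord k₀) {c₀ : ℝ} (hW : IsotropicWordGain W c₀) {n : ℕ} (hn : 0 < n)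
    {κ : ℝ} (hκ : 0 < κ) {ℓ : Fin 3 → ℤ} (hℓ : ℓ ≠ 0)
    (ζr : Fin k₀ → Fin 3 → ℝ) (hζ1 : ∀ j, ζr j ⬝ᵥ ζr j = 1) (hζ0 : ∀ j, ζr j ⬝ᵥ (fun i => ((ℓ i : ℤ) : ℝ)) = 0)
    (hζm : ∀ j, ζr j ⬝ᵥ (fun i => (((W.phase j).m i : ℤ) : ℝ)) = 0)
    (b : EuclideanSpace ℂ (Fin 3)) (hb : ∑ i, ((ℓ i : ℤ) : ℂ) * b i = 0) :
    ∑ j, κ * (4 * Real.pi ^ 2 * freqNormSq (fun i => (W.phase j).m i * (n : ℤ))) * (W.phase j).τ *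
        (2 * Real.pi * (∑ i, (W.phase j).e i * (ℓ i : ℝ)) *
            ‖Complex.exp ((W.phase j).φ * Complex.I) *
              (1 / (2 * ((2 * Real.pi * ‖latticeVec (W.phase j).m‖ : ℝ) : ℂ) * Complex.I))‖ *
            (1 / (n : ℝ)) / (κ * (4 * Real.pi ^ 2 * freqNormSq (fun i => (W.phase j).m i * (n : ℤ))))) ^ 2 *
        (‖inner ℂ (WithLp.toLp 2 (Complex.ofReal ∘ ζr j) : EuclideanSpace ℂ (Fin 3)) b‖ ^ 2 +
          ⟪(1 / ‖latticeVec (W.phase j).m‖) • latticeVec (W.phase j).m, (1 / ‖latticeVec ℓ‖) • latticeVec ℓ⟫ ^ 2 *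
            ‖inner ℂ (WithLp.toLp 2 (Complex.ofReal ∘
              (WithLp.ofLp ((1 / ‖latticeVec ℓ‖) • latticeVec ℓ) ⨯₃ ζr j)) : EuclideanSpace ℂ (Fin 3)) b‖ ^ 2) =
      2 * Real.pi ^ 2 * freqNormSq ℓ / (κ * (n : ℝ) ^ 4) * (c₀ * W.period) * ‖b‖ ^ 2 := by
  set A : ℝ := ‖latticeVec ℓ‖ with hA
  have hA0 : 0 < A := lt_of_lt_of_le one_pos (one_le_norm_latticeVec hℓ)
  set q : EuclideanSpace ℝ (Fin 3) := (1 / A) • latticeVec ℓ with hq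
  have hq1 : ‖q‖ = 1 := by
    rw [hq, norm_smul, Real.norm_eq_abs, abs_of_pos (by positivity), one_div, inv_mul_cancel₀ hA0.ne']
  have hinner : ∀ a b : EuclideanSpace ℝ (Fin 3), ⟪a, b⟫ = WithLp.ofLp a ⬝ᵥ WithLp.ofLp b := by
    intro a b
    rw [EuclideanSpace.inner_eq_star_dotProduct, star_trivial, dotProduct_comm]
  have hlr : WithLp.ofLp (latticeVec ℓ) = fun i => ((ℓ i : ℤ) : ℝ) := by
    funext i; simp [latticeVec_apply]
  -- the real and imaginary parts of `b`, both orthogonal to `q`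
  set pR : EuclideanSpace ℝ (Fin 3) := WithLp.toLp 2 (fun i => (b i).re) with hpR
  set pI : EuclideanSpace ℝ (Fin 3) := WithLp.toLp 2 (fun i => (b i).im) with hpI
  have hbre : (fun i => ((ℓ i : ℤ) : ℝ)) ⬝ᵥ (fun i => (b i).re) = 0 := by
    have h := congrArg Complex.re hb
    rw [Complex.re_sum] at h
    simp only [Complex.zero_re] at h
    rw [← h, dotProduct]
    refine Finset.sum_congr rfl fun i _ => ?_
    rw [show ((ℓ i : ℤ) : ℂ) = (((ℓ i : ℤ) : ℝ) : ℂ) by push_cast; rfl, Complex.re_ofReal_mul]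
  have hbim : (fun i => ((ℓ i : ℤ) : ℝ)) ⬝ᵥ (fun i => (b i).im) = 0 := by
    have h := congrArg Complex.im hb
    rw [Complex.im_sum] at h
    simp only [Complex.zero_im] at h
    rw [← h, dotProduct]
    refine Finset.sum_congr rfl fun i _ => ?_
    rw [show ((ℓ i : ℤ) : ℂ) = (((ℓ i : ℤ) : ℝ) : ℂ) by push_cast; rfl, Complex.im_ofReal_mul]
  have hpRq : ⟪pR, q⟫ = 0 := by
    rw [hinner, hq, WithLp.ofLp_smul, dotProduct_smul, hlr, dotProduct_comm]
    simp [hpR, hbre]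
  have hpIq : ⟪pI, q⟫ = 0 := by
    rw [hinner, hq, WithLp.ofLp_smul, dotProduct_smul, hlr, dotProduct_comm]
    simp [hpI, hbim]
  -- per slot: split `b` into its parts and use the frame identity twice
  have hslot : ∀ j, κ * (4 * Real.pi ^ 2 * freqNormSq (fun i => (W.phase j).m i * (n : ℤ))) * (W.phase j).τ *
        (2 * Real.pi * (∑ i, (W.phase j).e i * (ℓ i : ℝ)) *
            ‖Complex.exp ((W.phase j).φ * Complex.I) *
              (1 / (2 * ((2 * Real.pi * ‖latticeVec (W.phase j).m‖ : ℝ) : ℂ) * Complex.I))‖ *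
            (1 / (n : ℝ)) / (κ * (4 * Real.pi ^ 2 * freqNormSq (fun i => (W.phase j).m i * (n : ℤ))))) ^ 2 *
        (‖inner ℂ (WithLp.toLp 2 (Complex.ofReal ∘ ζr j) : EuclideanSpace ℂ (Fin 3)) b‖ ^ 2 +
          ⟪(1 / ‖latticeVec (W.phase j).m‖) • latticeVec (W.phase j).m, q⟫ ^ 2 *
            ‖inner ℂ (WithLp.toLp 2 (Complex.ofReal ∘ (WithLp.ofLp q ⨯₃ ζr j)) : EuclideanSpace ℂ (Fin 3)) b‖ ^ 2) =
      2 * Real.pi ^ 2 * freqNormSq ℓ / (κ * (n : ℝ) ^ 4) *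
        (slotGain (W.phase j) q pR + slotGain (W.phase j) q pI) := by
    intro j
    have hR := slot_exponent_frame (W.phase j) hn hκ hℓ (hζ1 j) (hζ0 j) (hζm j) pR hpRq
    have hI := slot_exponent_frame (W.phase j) hn hκ hℓ (hζ1 j) (hζ0 j) (hζm j) pI hpIq
    rw [← hA, ← hq] at hR hI
    rw [norm_sq_inner_toLp_ofReal, norm_sq_inner_toLp_ofReal]
    have e1 : WithLp.ofLp pR = fun i => (b i).re := rfl
    have e2 : WithLp.ofLp pI = fun i => (b i).im := rfl
    simp only [e1, e2] at hR hI
    linear_combination hR + hI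
  rw [Finset.sum_congr rfl fun j _ => hslot j, ← Finset.mul_sum, Finset.sum_add_distrib,
    isotropicWordGain_norm_sq hW q pR hq1 hpRq, isotropicWordGain_norm_sq hW q pI hq1 hpIq, norm_sq_eq_re_add_im b]
  ring

/-- The isotropic period sum as an UPPER bound (the `≤` form of `isotropic_exponent_sum`, which is how a budget
inequality consumes it): for any complex `b ⊥ ℓ` the polarisation-weighted slot exponents of one period sum to at most
`(2π²|ℓ|²/(κn⁴))·c₀·period·‖b‖²`. (Append-only re-land of this module, 2026-08-28: statement and proofs above unchanged.) -/
theorem isotropic_exponent_sum_le {k₀ : ℕ} (W : LatticeWord k₀) {c₀ : ℝ} (hW : IsotropicWordGain W c₀) {n : ℕ} (hn : 0 < n)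
    {κ : ℝ} (hκ : 0 < κ) {ℓ : Fin 3 → ℤ} (hℓ : ℓ ≠ 0)
    (ζr : Fin k₀ → Fin 3 → ℝ) (hζ1 : ∀ j, ζr j ⬝ᵥ ζr j = 1) (hζ0 : ∀ j, ζr j ⬝ᵥ (fun i => ((ℓ i : ℤ) : ℝ)) = 0)
    (hζm : ∀ j, ζr j ⬝ᵥ (fun i => (((W.phase j).m i : ℤ) : ℝ)) = 0)
    (b : EuclideanSpace ℂ (Fin 3)) (hb : ∑ i, ((ℓ i : ℤ) : ℂ) * b i = 0) :
    ∑ j, κ * (4 * Real.pi ^ 2 * freqNormSq (fun i => (W.phase j).m i * (n : ℤ))) * (W.phase j).τ *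
        (2 * Real.pi * (∑ i, (W.phase j).e i * (ℓ i : ℝ)) *
            ‖Complex.exp ((W.phase j).φ * Complex.I) *
              (1 / (2 * ((2 * Real.pi * ‖latticeVec (W.phase j).m‖ : ℝ) : ℂ) * Complex.I))‖ *
            (1 / (n : ℝ)) / (κ * (4 * Real.pi ^ 2 * freqNormSq (fun i => (W.phase j).m i * (n : ℤ))))) ^ 2 *
        (‖inner ℂ (WithLp.toLp 2 (Complex.ofReal ∘ ζr j) : EuclideanSpace ℂ (Fin 3)) b‖ ^ 2 +
          ⟪(1 / ‖latticeVec (W.phase j).m‖) • latticeVec (W.phase j).m, (1 / ‖latticeVec ℓ‖) • latticeVec ℓ⟫ ^ 2 *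
            ‖inner ℂ (WithLp.toLp 2 (Complex.ofReal ∘
              (WithLp.ofLp ((1 / ‖latticeVec ℓ‖) • latticeVec ℓ) ⨯₃ ζr j)) : EuclideanSpace ℂ (Fin 3)) b‖ ^ 2) ≤
      2 * Real.pi ^ 2 * freqNormSq ℓ / (κ * (n : ℝ) ^ 4) * (c₀ * W.period) * ‖b‖ ^ 2 :=
  (isotropic_exponent_sum W hW hn hκ hℓ ζr hζ1 hζ0 hζm b hb).le

end Summit.AnomalousDissipation.AnomalousDissipation.Theorems.SolenoidalFractalHomogenisation.RealisedQuasiStaticCellLaw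

end
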